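import Mathlib
import Summits.ValiantsHypothesis.ValiantsHypothesis.Theses.FeketeSOS

/-!
# FeketeSOS — `SplitOfTwoSquares` (item stmt-ValiantsHypothesis-4001)

Two weighted squares are a splitting: if `c₀ g₀² + c₁ g₁² = F_p` over `ℂ`, then
`F_p = A · B` with `A = a g₀ + i b g₁`, `B = a g₀ − i b g₁` where `a² = c₀`, `b² = c₁`
(square roots exist since `ℂ` is algebraically closed), and
`|supp A| + |supp B| ≤ 2 (|supp g₀| + |supp g₁|)` because scaling does not enlarge the support
and the support of a sum lies in the union of the supports.  Folklore algebra; this is the glue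
turning `FeketeNoSparseSplit` into the `s ≤ 2` case of the route thesis.
-/

-- `Summit.ValiantsHypothesis.ValiantsHypothesis.…` is the tree's mandated single-conjunct layout
-- (Sub = Summit), so the duplicated namespace component is intended.
set_option linter.dupNamespace false

namespace Summit.ValiantsHypothesis.ValiantsHypothesis.Theorems.FeketeSOSSplitOfTwoSquares

open Polynomial

/-- Scaling a polynomial by a constant and adding another scaled polynomial: the support of
`C a * g + C b * h` has at most `|supp g| + |supp h|` elements. -/
theorem card_support_C_mul_add_C_mul_le (a b : ℂ) (g h : Polynomial ℂ) :
    (C a * g + C b * h).support.card ≤ g.support.card + h.support.card := by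
  calc (C a * g + C b * h).support.card
      ≤ ((C a * g).support ∪ (C b * h).support).card :=
        Finset.card_le_card Polynomial.support_add
    _ ≤ (C a * g).support.card + (C b * h).support.card := Finset.card_union_le _ _
    _ ≤ g.support.card + h.support.card := by
        gcongr
        · simpa only [Polynomial.smul_eq_C_mul] using Polynomial.support_smul a g
        · simpa only [Polynomial.smul_eq_C_mul] using Polynomial.support_smul b h

/-- **SplitOfTwoSquares** (item stmt-ValiantsHypothesis-4001 of route FeketeSOS): a weighted
sum of two squares equal to the Fekete polynomial `F_p` yields a factorisation `F_p = A · B` with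
`|supp A| + |supp B| ≤ 2 (|supp g₀| + |supp g₁|)`, namely `A = a g₀ + i b g₁`, `B = a g₀ − i b g₁`
with `a² = c₀`, `b² = c₁`. -/
theorem splitOfTwoSquares_proof :
    Summit.ValiantsHypothesis.ValiantsHypothesis.Theses.FeketeSOS.SplitOfTwoSquares := by
  unfold Summit.ValiantsHypothesis.ValiantsHypothesis.Theses.FeketeSOS.SplitOfTwoSquares
  intro p _ c g hsum
  obtain ⟨a, ha⟩ := IsAlgClosed.exists_pow_nat_eq (c 0) (n := 2) two_pos
  obtain ⟨b, hb⟩ := IsAlgClosed.exists_pow_nat_eq (c 1) (n := 2) two_pos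
  refine ⟨C a * g 0 + C (Complex.I * b) * g 1, C a * g 0 + C (-(Complex.I * b)) * g 1, ?_, ?_⟩
  · -- the product is `C (a²) g₀² - C ((I b)²) g₁² = C c₀ g₀² + C c₁ g₁²`
    rw [← hsum, Fin.sum_univ_two, ← ha, ← hb]
    have hI : (Complex.I * b) ^ 2 = -(b ^ 2) := by
      rw [mul_pow, Complex.I_sq]; ring
    have key : (C a * g 0 + C (Complex.I * b) * g 1) * (C a * g 0 + C (-(Complex.I * b)) * g 1)
        = C (a ^ 2) * g 0 ^ 2 - C ((Complex.I * b) ^ 2) * g 1 ^ 2 := by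
      simp only [map_neg, map_pow, map_mul]
      ring
    rw [key, hI, map_neg]
    ring
  · have h0 := card_support_C_mul_add_C_mul_le a (Complex.I * b) (g 0) (g 1)
    have h1 := card_support_C_mul_add_C_mul_le a (-(Complex.I * b)) (g 0) (g 1)
    omega

end Summit.ValiantsHypothesis.ValiantsHypothesis.Theorems.FeketeSOSSplitOfTwoSquares
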